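import Literature.NumberTheory.Sieve.BombieriFriedlanderIwaniecBoxes
import Literature.NumberTheory.Sieve.BombieriFriedlanderIwaniecDecomposition
import Literature.NumberTheory.Sieve.DivisorPowerSums

/-!
# Correlation sieve for line `Sketch` of the crux `EngineToPairs` (stmt-Parity-14659), part 1:
# the correlation functional, Heath-Brown's identity, dyadic box-tuples

Support file for the stub `stub_sieve : CorrelationSieveFamily` (Defs:
`Theorems/LiouvilleShiftedTablesEngineToPairsDefs.lean`).  The sieve bounds, for a family of weights
`w q`, the correlation functional `corrFun (w q) x F = ∑_{x/2 < n ≤ x} F(n) w_q(n)` at `F = Λ`.  This file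
is the purely combinatorial first layer, transplanted from the tree's BFI §15 pipeline
(`Literature.NumberTheory.Sieve.BFI.sievedDisc` ↦ `corrFun`):

* `corrFun` and its linearity / locality / trivial bound;
* `corrFun_vonMangoldt_eq` — Heath-Brown's identity with `K = 3` pushed through the functional:
  `corrFun w x Λ = ∑_{j=1}^{3} (−1)^{j+1} C(3,j) corrFun w x (hbPiece U j)` for `⌊x⌋ ≤ U³`;
* `corrFun_prod_eq_sum_tuples` — the multilinear expansion of a Dirichlet product of factors into DYADIC
  box-tuples (`BFI.boxRestrict x 1 k`: the box `(x/2^{k+1}, x/2^k]`), valid for `x < 2^K`;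
* `splitLow V F`, `splitHigh V F` — the split of a factor at a threshold `V` (`F = F·1_{≤V} + F·1_{>V}`)
  and the binomial expansion `prod_add_split` of a product of split factors over the subsets `L` of indices.
-/

noncomputable section

namespace Summit.Parity.GeneralizedHardyLittlewood.Theorems.EngineToPairs.Sieve

open Finset Real
open scoped ArithmeticFunction.vonMangoldt ArithmeticFunction.zeta
open Literature.NumberTheory.Sieve Literature.NumberTheory.Sieve.BFI

/-! ### The correlation functional -/

/-- The correlation functional of the weight `w` at scale `x`: `corrFun w x F = ∑_{x/2 < n ≤ x} F(n) w(n)`.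
[this line] -/
def corrFun (w : ℕ → ℝ) (x : ℝ) (F : ℕ → ℝ) : ℝ := ∑ n ∈ Ioc ⌊x / 2⌋₊ ⌊x⌋₊, F n * w n

/-- `corrFun` depends only on `F` on `(x/2, x]`. [folklore] -/
theorem corrFun_congr {w : ℕ → ℝ} {x : ℝ} {F G : ℕ → ℝ} (h : ∀ n ∈ Ioc ⌊x / 2⌋₊ ⌊x⌋₊, F n = G n) :
    corrFun w x F = corrFun w x G :=
  Finset.sum_congr rfl fun n hn => by rw [h n hn]

/-- Additivity of `corrFun` in `F`. [folklore] -/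
theorem corrFun_add (w : ℕ → ℝ) (x : ℝ) (F G : ℕ → ℝ) :
    corrFun w x (fun n => F n + G n) = corrFun w x F + corrFun w x G := by
  unfold corrFun; rw [← Finset.sum_add_distrib]; exact Finset.sum_congr rfl fun n _ => by ring

/-- Homogeneity of `corrFun` in `F`. [folklore] -/
theorem corrFun_smul (w : ℕ → ℝ) (x : ℝ) (c : ℝ) (F : ℕ → ℝ) :
    corrFun w x (fun n => c * F n) = c * corrFun w x F := by
  unfold corrFun; rw [Finset.mul_sum]; exact Finset.sum_congr rfl fun n _ => by ring

/-- Linearity of `corrFun` over finite sums with coefficients. [folklore] -/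
theorem corrFun_sum {ι : Type*} (s : Finset ι) (c : ι → ℝ) (F : ι → ℕ → ℝ) (w : ℕ → ℝ) (x : ℝ) :
    corrFun w x (fun n => ∑ i ∈ s, c i * F i n) = ∑ i ∈ s, c i * corrFun w x (F i) := by
  classical
  induction s using Finset.induction_on with
  | empty => simp [corrFun]
  | @insert i s hi ih =>
    simp only [Finset.sum_insert hi]
    rw [← ih, ← corrFun_smul, ← corrFun_add]

/-- Linearity of `corrFun` over finite sums (no coefficients). [folklore] -/
theorem corrFun_sum' {ι : Type*} (s : Finset ι) (F : ι → ℕ → ℝ) (w : ℕ → ℝ) (x : ℝ) :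
    corrFun w x (fun n => ∑ i ∈ s, F i n) = ∑ i ∈ s, corrFun w x (F i) := by
  have := corrFun_sum s (fun _ => (1 : ℝ)) F w x
  simpa using this

/-- `corrFun` of an arithmetic-function-valued finite sum. [folklore] -/
theorem corrFun_finset_sum_apply {ι : Type*} (s : Finset ι) (F : ι → ArithmeticFunction ℝ) (w : ℕ → ℝ)
    (x : ℝ) : corrFun w x (fun n => (∑ i ∈ s, F i) n) = ∑ i ∈ s, corrFun w x (fun n => F i n) := by
  rw [← corrFun_sum']
  exact corrFun_congr fun n _ => HeathBrown.finset_sum_apply s F n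

/-! ### Heath-Brown's identity through the functional -/

/-- **Heath-Brown's identity (`K = 3`) applied to the correlation functional**: if `⌊x⌋ ≤ U³` then
`corrFun w x Λ = ∑_{j=1}^{3} (−1)^{j+1} C(3,j) · corrFun w x (hbPiece U j)`.
[cite: Heathbrown1982, Lemma 1] -/
theorem corrFun_vonMangoldt_eq {x : ℝ} {U : ℕ} (hU : ⌊x⌋₊ ≤ U ^ 3) (w : ℕ → ℝ) :
    corrFun w x (fun n => Λ n) =
      ∑ j ∈ Icc 1 3, (-1 : ℝ) ^ (j + 1) * (Nat.choose 3 j : ℝ) * corrFun w x (fun n => hbPiece U j n) := by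
  have hcongr : ∀ n ∈ Ioc ⌊x / 2⌋₊ ⌊x⌋₊, (Λ n : ℝ) =
      ∑ j ∈ Icc 1 3, ((-1 : ℝ) ^ (j + 1) * (Nat.choose 3 j : ℝ)) * hbPiece U j n := by
    intro n hn
    have hn3 : n ≤ U ^ 3 := (mem_Ioc.1 hn).2.trans hU
    rw [heathBrown_identity_nat (K := 3) (by norm_num) U hn3]
    rfl
  rw [corrFun_congr hcongr, corrFun_sum]

/-! ### Dyadic box-tuples -/

/-- **Multilinear expansion into dyadic box-tuples** through the functional: for a finite index type `ι`,
`0 < x < 2^K`, `corrFun w x (∏_i f_i) = ∑_{κ : ι → {0,…,K−1}} corrFun w x (∏_i boxRestrict x 1 (κ i) f_i)`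
(dyadic boxes `(x/2^{k+1}, x/2^k]`). [cite: BombieriFriedlanderIwaniecActa1986, §15 pp. 245–246] -/
theorem corrFun_prod_eq_sum_tuples {ι : Type*} [DecidableEq ι] [Fintype ι] {x : ℝ} (hx : 0 < x) {K : ℕ}
    (hK : x < (2 : ℝ) ^ K) (f : ι → ArithmeticFunction ℝ) (w : ℕ → ℝ) :
    corrFun w x (fun n => (∏ i, f i) n) =
      ∑ κ ∈ Fintype.piFinset (fun _ : ι => Finset.range K),
        corrFun w x (fun n => (∏ i, boxRestrict x 1 (κ i) (f i)) n) := by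
  rw [← corrFun_sum']
  refine corrFun_congr fun n hn => ?_
  have hnx : (n : ℝ) ≤ x := by
    have := (mem_Ioc.1 hn).2
    exact (Nat.cast_le.2 this).trans (Nat.floor_le hx.le)
  have hK' : x < (1 + (1 : ℝ)) ^ K := by rw [one_add_one_eq_two]; exact hK
  rw [prod_apply_eq_sum_prod_boxRestrict_apply hx one_pos hK' f hnx]

/-! ### Splitting a factor at a threshold -/

/-- The part of `F` supported on `n ≤ V`. [folklore] -/
def splitLow (V : ℝ) (F : ArithmeticFunction ℝ) : ArithmeticFunction ℝ where
  toFun n := if (n : ℝ) ≤ V then F n else 0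
  map_zero' := by simp

/-- The part of `F` supported on `n > V`. [folklore] -/
def splitHigh (V : ℝ) (F : ArithmeticFunction ℝ) : ArithmeticFunction ℝ where
  toFun n := if (n : ℝ) ≤ V then 0 else F n
  map_zero' := by simp

/-- Unfolding `splitLow`. [folklore] -/
theorem splitLow_apply (V : ℝ) (F : ArithmeticFunction ℝ) (n : ℕ) :
    splitLow V F n = if (n : ℝ) ≤ V then F n else 0 := rfl

/-- Unfolding `splitHigh`. [folklore] -/
theorem splitHigh_apply (V : ℝ) (F : ArithmeticFunction ℝ) (n : ℕ) :
    splitHigh V F n = if (n : ℝ) ≤ V then 0 else F n := rfl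

/-- `F = F·1_{≤V} + F·1_{>V}`. [folklore] -/
theorem splitLow_add_splitHigh (V : ℝ) (F : ArithmeticFunction ℝ) : splitLow V F + splitHigh V F = F := by
  ext n
  simp only [ArithmeticFunction.add_apply, splitLow_apply, splitHigh_apply]
  split_ifs <;> simp

/-- `|splitLow V F| ≤ |F|`. [folklore] -/
theorem abs_splitLow_le (V : ℝ) (F : ArithmeticFunction ℝ) (n : ℕ) : |splitLow V F n| ≤ |F n| := by
  rw [splitLow_apply]; split_ifs <;> simp

/-- `|splitHigh V F| ≤ |F|`. [folklore] -/
theorem abs_splitHigh_le (V : ℝ) (F : ArithmeticFunction ℝ) (n : ℕ) : |splitHigh V F n| ≤ |F n| := by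
  rw [splitHigh_apply]; split_ifs <;> simp

/-- Support of `splitHigh`: `splitHigh V F n ≠ 0 → V < n`. [folklore] -/
theorem lt_of_splitHigh_ne_zero {V : ℝ} {F : ArithmeticFunction ℝ} {n : ℕ} (h : splitHigh V F n ≠ 0) :
    V < n := by
  rw [splitHigh_apply] at h
  by_contra hle
  exact h (if_pos (not_lt.1 hle))

/-- Support of `splitLow`: `splitLow V F n ≠ 0 → n ≤ V`. [folklore] -/
theorem le_of_splitLow_ne_zero {V : ℝ} {F : ArithmeticFunction ℝ} {n : ℕ} (h : splitLow V F n ≠ 0) :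
    (n : ℝ) ≤ V := by
  rw [splitLow_apply] at h
  by_contra hle
  exact h (if_neg hle)

/-- The split factor selected by a set `L` of indices: the high part on `L`, the low part off `L`. [this line] -/
def splitSel {ι : Type*} [DecidableEq ι] (V : ℝ) (L : Finset ι) (f : ι → ArithmeticFunction ℝ) (i : ι) :
    ArithmeticFunction ℝ :=
  if i ∈ L then splitHigh V (f i) else splitLow V (f i)

/-- **Binomial expansion of a product of split factors**: with `P` the set of indices that are split
(the others kept whole), `∏_i f_i = ∑_{L ⊆ P} ∏_i g^{L}_i` where `g^{L}_i = f_i` for `i ∉ P`, the high part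
for `i ∈ L` and the low part for `i ∈ P ∖ L`. [folklore] -/
theorem prod_eq_sum_powerset_prod_splitSel {ι : Type*} [DecidableEq ι] [Fintype ι] (V : ℝ) (P : Finset ι)
    (f : ι → ArithmeticFunction ℝ) :
    (∏ i, f i) = ∑ L ∈ P.powerset, ∏ i, (if i ∈ P then splitSel V L f i else f i) := by
  classical
  -- write each split factor as low + high and expand the product over `P`
  have hsplit : ∀ i, f i = (if i ∈ P then splitHigh V (f i) else 0) + (if i ∈ P then splitLow V (f i) else f i) := by
    intro i
    split_ifs with hi
    · rw [add_comm]; exact (splitLow_add_splitHigh V (f i)).symm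
    · simp
  conv_lhs => rw [show (∏ i, f i) = ∏ i, ((if i ∈ P then splitHigh V (f i) else 0) +
      (if i ∈ P then splitLow V (f i) else f i)) from Finset.prod_congr rfl fun i _ => hsplit i]
  rw [Finset.prod_add]
  -- terms with `L ⊄ P` vanish (a factor `0`), the others are the `splitSel` products
  rw [← Finset.sum_subset (Finset.powerset_mono.2 (Finset.subset_univ P))]
  · refine Finset.sum_congr rfl fun L hL => ?_
    rw [Finset.mem_powerset] at hL
    have h1 : ∏ i ∈ L, (if i ∈ P then splitHigh V (f i) else 0) = ∏ i ∈ L, splitSel V L f i := by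
      refine Finset.prod_congr rfl fun i hi => ?_
      rw [if_pos (hL hi), splitSel, if_pos hi]
    have h2 : ∏ i ∈ univ \ L, (if i ∈ P then splitLow V (f i) else f i) =
        ∏ i ∈ univ \ L, (if i ∈ P then splitSel V L f i else f i) := by
      refine Finset.prod_congr rfl fun i hi => ?_
      have hiL : i ∉ L := (Finset.mem_sdiff.1 hi).2
      split_ifs with hiP
      · rw [splitSel, if_neg hiL]
      · rfl
    rw [h1, h2]
    have h3 : ∏ i ∈ L, splitSel V L f i = ∏ i ∈ L, (if i ∈ P then splitSel V L f i else f i) :=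
      Finset.prod_congr rfl fun i hi => by rw [if_pos (hL hi)]
    rw [h3, ← Finset.prod_union (Finset.disjoint_sdiff), Finset.union_sdiff_of_subset (Finset.subset_univ L)]
  · intro L _ hLP
    rw [Finset.mem_powerset] at hLP
    obtain ⟨i, hiL, hiP⟩ := Finset.not_subset.1 hLP
    rw [Finset.prod_eq_zero hiL (by rw [if_neg hiP]), zero_mul]

end Summit.Parity.GeneralizedHardyLittlewood.Theorems.EngineToPairs.Sieve

end
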